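import Mathlib
import Summits.Ventures.PercRepro2.IncReimer
import Summits.Ventures.PercRepro2.ReimerUnion

/-!
# (INC-REIMER) is a theorem: the Reimer slack is monotone in the split set
(seat mine-b, cell pub-perc-repro2; conjectures/MINE-B.md §13 Addendum 8)

The row (INC-REIMER) of IncReimer.lean — for increasing `A`, `B`, pins `O`, split set `Y` and
`q ∉ O ∪ Y`, `reimerSlack A B O Y ≤ reimerSlack A B O (insert q Y)` — follows from mine-1's
**union Reimer** (`reimer_union`, MINE-1 Theorem 16.7).  Splitting the configurations of `insert q Y`
by the colour of `q`, the increment of the slack is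
  `#{γ ⊆ Y : (A₀ γ ∧ B₁ ρ) ∨ (A₁ γ ∧ B₀ ρ)} − #{γ ⊆ Y : A □ B at O ∪ insert q γ}`
with `A₀ = A(O ∪ ·)`, `A₁ = A(O ∪ insert q ·)` (likewise `B₀ ⊆ B₁`) and `ρ = Y \ γ`: the inclusion–exclusion
term `#{A₀ ∧ B₀}` is exactly the small pattern's first count.  A disjoint occurrence in `O ∪ insert q γ`
hands `q` to one of the two witnesses, so it is a cube-level occurrence of the nested pair `(A₀, B₁)` or
`(A₁, B₀)` (`dOcc_pinned_insert`), and union Reimer bounds the union of those by the union of the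
two targets.  Hence `incReimer_of_incr`, and with `reimerSlack_nonneg_of_incReimer` an inductive proof
of Reimer's inequality on every pattern; with `reimerSlack_self_eq_slack`, (SPLIT-MONO) holds at the
row `(0,2)` for every increasing event (`splitMono_zero_two`).
-/

open Finset

namespace Summit.Ventures.PercRepro2

namespace StepZero

open ReimerCube

variable {E : Type*} [DecidableEq E]

open Classical

/-- a disjoint occurrence of `A`, `B` in `O ∪ insert q γ` is a cube-level disjoint occurrence on `γ` of the
pinned pair with `q` handed to the `B`-side or to the `A`-side -/
lemma dOcc_pinned_insert {A B : Finset E → Prop} (O : Finset E) (q : E)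
    (γ : Finset E) (h : DOcc A B (O ∪ insert q γ)) :
    DOcc (fun S => A (O ∪ S)) (fun S => B (O ∪ insert q S)) γ ∨
      DOcc (fun S => A (O ∪ insert q S)) (fun S => B (O ∪ S)) γ := by
  obtain ⟨K, L, hK, hL, hKL, hAK, hBL⟩ := h
  have hKL' : Disjoint (K ∩ γ) (L ∩ γ) :=
    Finset.disjoint_of_subset_left Finset.inter_subset_left
      (Finset.disjoint_of_subset_right Finset.inter_subset_left hKL)
  by_cases hqK : q ∈ K
  · -- `q` is used by the `A`-witness
    right
    refine ⟨K ∩ γ, L ∩ γ, Finset.inter_subset_right, Finset.inter_subset_right, hKL', ?_, ?_⟩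
    · intro T hT
      apply hAK
      intro x hx
      have hx' := hK hx
      rw [Finset.mem_union, Finset.mem_insert] at hx'
      rw [Finset.mem_union, Finset.mem_insert]
      rcases hx' with hx' | rfl | hx'
      · exact Or.inl hx'
      · exact Or.inr (Or.inl rfl)
      · exact Or.inr (Or.inr (hT (Finset.mem_inter.mpr ⟨hx, hx'⟩)))
    · intro T hT
      apply hBL
      intro x hx
      have hx' := hL hx
      have hxq : x ≠ q := fun h => Finset.disjoint_left.mp hKL hqK (h ▸ hx)
      rw [Finset.mem_union, Finset.mem_insert] at hx'
      rw [Finset.mem_union]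
      rcases hx' with hx' | hx' | hx'
      · exact Or.inl hx'
      · exact absurd hx' hxq
      · exact Or.inr (hT (Finset.mem_inter.mpr ⟨hx, hx'⟩))
  · -- `q` is not used by the `A`-witness: hand it to the `B`-side
    left
    refine ⟨K ∩ γ, L ∩ γ, Finset.inter_subset_right, Finset.inter_subset_right, hKL', ?_, ?_⟩
    · intro T hT
      apply hAK
      intro x hx
      have hx' := hK hx
      have hxq : x ≠ q := fun h => hqK (h ▸ hx)
      rw [Finset.mem_union, Finset.mem_insert] at hx'
      rw [Finset.mem_union]
      rcases hx' with hx' | hx' | hx'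
      · exact Or.inl hx'
      · exact absurd hx' hxq
      · exact Or.inr (hT (Finset.mem_inter.mpr ⟨hx, hx'⟩))
    · intro T hT
      apply hBL
      intro x hx
      have hx' := hL hx
      rw [Finset.mem_union, Finset.mem_insert] at hx'
      rw [Finset.mem_union, Finset.mem_insert]
      rcases hx' with hx' | rfl | hx'
      · exact Or.inl hx'
      · exact Or.inr (Or.inl rfl)
      · exact Or.inr (Or.inr (hT (Finset.mem_inter.mpr ⟨hx, hx'⟩)))

/-- **(INC-REIMER) holds for all increasing events** — a corollary of union Reimer. -/
theorem incReimer_of_incr {A B : Finset E → Prop} (hA : Incr A) (hB : Incr B) : IncReimer A B := by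
  intro O Y q hqO hqY
  unfold reimerSlack
  rw [card_filter_powerset_insert hqY, card_filter_powerset_insert hqY]
  -- the pinned events on the `γ`-cube
  set A₀ : Finset E → Prop := fun S => A (O ∪ S) with hA₀
  set A₁ : Finset E → Prop := fun S => A (O ∪ insert q S) with hA₁
  set B₀ : Finset E → Prop := fun S => B (O ∪ S) with hB₀
  set B₁ : Finset E → Prop := fun S => B (O ∪ insert q S) with hB₁
  have iA₀ : Incr A₀ := fun _ _ h hS => hA (Finset.union_subset_union_right h) hS
  have iA₁ : Incr A₁ := fun _ _ h hS =>
    hA (Finset.union_subset_union_right (Finset.insert_subset_insert q h)) hS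
  have iB₀ : Incr B₀ := fun _ _ h hS => hB (Finset.union_subset_union_right h) hS
  have iB₁ : Incr B₁ := fun _ _ h hS =>
    hB (Finset.union_subset_union_right (Finset.insert_subset_insert q h)) hS
  have hA01 : ∀ S, A₀ S → A₁ S := fun S h =>
    hA (Finset.union_subset_union_right (Finset.subset_insert q S)) h
  have hB01 : ∀ S, B₀ S → B₁ S := fun S h =>
    hB (Finset.union_subset_union_right (Finset.subset_insert q S)) h
  -- the two halves of the first count of the bigger pattern
  have e1 : Y.powerset.filter (fun γ => A (O ∪ γ) ∧ B (O ∪ (insert q Y \ γ)))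
      = Y.powerset.filter (fun γ => A₀ γ ∧ B₁ (Y \ γ)) := by
    apply Finset.filter_congr
    intro γ hγ
    rw [Finset.mem_powerset] at hγ
    rw [insert_sdiff_of_not_mem' hγ hqY]
  have e2 : Y.powerset.filter (fun γ => A (O ∪ insert q γ) ∧ B (O ∪ (insert q Y \ insert q γ)))
      = Y.powerset.filter (fun γ => A₁ γ ∧ B₀ (Y \ γ)) := by
    apply Finset.filter_congr
    intro γ _
    rw [insert_sdiff_insert' hqY]
  rw [e1, e2]
  -- inclusion–exclusion: the intersection of the two halves is the small pattern's first count
  have hie := Finset.card_union_add_card_inter (Y.powerset.filter (fun γ => A₀ γ ∧ B₁ (Y \ γ)))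
    (Y.powerset.filter (fun γ => A₁ γ ∧ B₀ (Y \ γ)))
  rw [← Finset.filter_or, ← Finset.filter_and] at hie
  have e3 : Y.powerset.filter (fun γ => (A₀ γ ∧ B₁ (Y \ γ)) ∧ (A₁ γ ∧ B₀ (Y \ γ)))
      = Y.powerset.filter (fun γ => A (O ∪ γ) ∧ B (O ∪ (Y \ γ))) := by
    apply Finset.filter_congr
    intro γ _
    constructor
    · rintro ⟨⟨h1, -⟩, -, h4⟩; exact ⟨h1, h4⟩
    · rintro ⟨h1, h4⟩; exact ⟨⟨h1, hB01 _ h4⟩, hA01 _ h1, h4⟩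
  rw [e3] at hie
  -- union Reimer on the nested pairs `(A₀, B₁) ⊆ (A₁, B₀)` bounds the disjoint occurrences with `q`
  have hur := reimer_union Y A₀ A₁ B₁ B₀ iA₀ iA₁ iB₁ iB₀ hA01 hB01
  have hsub : (Y.powerset.filter (fun γ => DOcc A B (O ∪ insert q γ))).card
      ≤ (Y.powerset.filter (fun γ => DOcc A₀ B₁ γ ∨ DOcc A₁ B₀ γ)).card := by
    apply Finset.card_le_card
    intro γ hγ
    rw [Finset.mem_filter] at hγ ⊢
    exact ⟨hγ.1, dOcc_pinned_insert O q γ hγ.2⟩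
  omega

/-- **(SPLIT-MONO) at the row `(0,2)` for every increasing event**: the STEP slack `H(1,1) − H(0,2)` never
decreases when an element joins the split set. -/
theorem splitMono_zero_two {A : Finset E → Prop} (hA : Incr A) (O Y : Finset E) (q : E)
    (hqO : q ∉ O) (hqY : q ∉ Y) : slack A O Y 0 2 ≤ slack A O (insert q Y) 0 2 := by
  rw [← reimerSlack_self_eq_slack hA, ← reimerSlack_self_eq_slack hA]
  exact incReimer_of_incr hA hA O Y q hqO hqY

end StepZero

end Summit.Ventures.PercRepro2
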